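import Summits.QuantumFields.YangMills.Theorems.BalabanUVNodesN15KingModelProp37AtRegularFieldEntryLines
import Summits.QuantumFields.YangMills.Theorems.BalabanUVNodesN15KingModelProp37AtRegularField

/-!
# N15 (NE2⁺, row s3 KING-MODEL ∕ RIEMANN-KERNEL RUNG) — PART Ζ-h₃: KING 1986 PROPOSITION 3.7 BY NAME AT A REGULAR BACKGROUND FOR THE MATRIX ENTRIES
# `G_(j)(x,y)_{ii′}` — King's own transport-free reading, IN KING's GAUGE (`|A_b| ≤ A_∞`, `d|e|A_∞L^kε ≤ 1`)

count-neutral helper of the pub-ymgap K3⁸ programme (`--supports stmt-QuantumFields-27366`); nothing here is a claim about Bałaban's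
non-abelian `G(U)`, the continuum, ℝ⁴, OS axioms, a mass gap or the Clay problem.  One finite torus `T_ε` at fixed `ε`.

[King1986] Prop. 3.7 (3.62)–(3.65) p. 663 — `(∂_α(x,y)G)(z) = |x − y|^{−α}{G(x,z) − G(y,z)}` read on the ENTRIES of the `N × N` blocks; King's gauge p. 661
(3.43)–(3.46) with *"|Ã^{(k)}(x)| ≤ Cp(L^kε)|x − x₀|. (3.45)"*; p. 665 «also holds for G_(j)(□′, Ã^{(k)})».  [Balaban1983Higgs3] (2.10)–(2.11) p. 426 (lit-balaban p26).

## What this file proves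

* §1 def `kingSliceKernelsRegEnt S C A m² a k i i′ : SliceKernels P.d` — PART Ζ-b's datum with the block norm replaced by the `(i,i′)` ENTRY: `G j x y =
  (L^kε)^{d−2}·entG`, `dG j μ x y = (L^kε)^{d−1}·entDG` (Ζ-h₁), same sites∕distance∕units, `B = PEmpty`; `two_lt_sitesPerDir`.
* §2 ★★ `prop37PrintedAt_entry_of` (transfer from p26's (2.10)∕(2.11) + Ζ-h₁∕h₂ under the gauge hypothesis; constants `((3d·e^{δ(d+1)} + 2)·C, δ)`).
* §3 ★★★ **`prop37PrintedAt_king_regularField_entry`** — PROP 3.7 BY NAME FOR THE ENTRIES at a regular `A ≠ 0` on `T_ε`, King's order, with the extra GAUGE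
  HYPOTHESIS `∀ b, |A_b| ≤ A_∞`, `d·|e|·A_∞·L^kε ≤ 1`; ★★★ `prop37KingOrder_king_zeroField_entry` (`A = 0`: both hypotheses trivial) — King's (3.62)∕(3.65)
  in King's own reading for King's own `A = 0` model through the regular-field pipeline, and at every small-sup-norm regular `A`.

HONEST SCOPE.  The gauge hypothesis is explicit and NOT implied by regularity (2.23); without it only the gauge-invariant block-norm reading (PARTS Ζ-a…Ζ-f)
holds.  `Ω = T_ε`; cubic tori of the `Shape` sub-family; constants per `(α, K₀)`; (3.64) empty by type here (vector clause: PART Ζ-d).  NOT an η-rate;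
NE2⁺ for Bałaban's `G(U)` NOT proved; N15 NOT discharged.  Unit `pub-ymgap-dag-n15-e` g22 (R141 (C) s3), PART Ζ-h₃.
-/

noncomputable section

open scoped BigOperators

namespace Summit.QuantumFields.YangMills.BalabanUVNodes.N15KingModelRung.RegularField

open Literature.MathematicalPhysics.QuantumFieldTheory.Balaban1983to89
open Literature.MathematicalPhysics.QuantumFieldTheory.Balaban1983to89.HiggsLattice (ChargeData ScalarField covDeriv)
open Literature.MathematicalPhysics.QuantumFieldTheory.Balaban1983to89.B1Eq230FluctCov (Ix cb)
open Literature.MathematicalPhysics.QuantumFieldTheory.Balaban1983to89.B1Ineq234LevelZero (tdist_comm)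
open Literature.MathematicalPhysics.QuantumFieldTheory.Balaban1983to89.B1Ineq234Concrete (tdist_self)
open Literature.MathematicalPhysics.QuantumFieldTheory.Balaban1983to89.B3Sect2StatementsPart2 (ScaledKernels)
open Literature.MathematicalPhysics.QuantumFieldTheory.Balaban1983to89.B1Eq211ZeroFieldTorus (Shape)
open Literature.MathematicalPhysics.QuantumFieldTheory.Balaban1983to89.B3Ineq210RegularTorus (regTorusKernels regTorusKernels_absG
  regTorusKernels_absDG regTorusKernels_dist scale_eq mesh_eq_pow_mul)
open Literature.MathematicalPhysics.QuantumFieldTheory.Balaban1983to89.B3Ineq211RegularTorus (one_le_tdist_of_ne' regTorusKernelsH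
  ineq210_iff_H ineq210_and_211At_regularTorusH)
open Literature.MathematicalPhysics.QuantumFieldTheory.King1986.SlicePropagator (SliceKernels holderDeriv Prop37PrintedAt Prop37KingOrder)
open Literature.MathematicalPhysics.QuantumFieldTheory.King1986 (ContinuumLimit.eps)

variable {P : HiggsLattice.Params} {N : ℕ}

/-! ## §1 The entrywise datum -/

/-- ★ **KING's PROP-3.7 DATUM AT THE REGULAR BACKGROUND `A`, ENTRY `(i,i′)`** (`η = L^{−k}` units): sites of `T_ε`, `dist = L^{−k}|x−y|`,
`G j x y = (L^kε)^{d−2}·G^η_{(j)}(x,y)_{ii′}`, `dG j μ x y = (L^kε)^{d−1}·(D_{A,μ}G^η_{(j)})(x,y)_{ii′}`, `B = PEmpty`. [cite: King1986, Prop 3.7 (3.62)–(3.65) p.663]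
[cite: Balaban1983Higgs3, (2.10) p.426] -/
def kingSliceKernelsRegEnt (_S : Shape P) (C : ChargeData N) (A : HiggsLattice.VecField P 0) (msq a : ℝ) (k : ℕ) (i i' : Ix N) :
    SliceKernels P.d where
  S := HiggsLattice.Site P 0
  B := PEmpty
  dist x y := (HiggsLattice.Site.tdist x y : ℝ) / (P.L : ℝ) ^ k
  distBlockBond _ _ b := b.elim
  L := P.L
  k := k
  G j x y := P.mesh k ^ ((P.d : ℝ) - 2) * entG C A msq a k j i i' x y
  dG j μ x y := P.mesh k ^ ((P.d : ℝ) - 1) * entDG C A msq a k j μ i i' x y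
  Gc _ _ b := b.elim

section Ent

variable {S : Shape P} {C : ChargeData N} {A : HiggsLattice.VecField P 0} {msq a : ℝ} {k : ℕ} {i i' : Ix N}

/-- same slice lengths as PART Ζ-b's datum. [cite: King1986, (3.63) p.663] -/
theorem slice_ent (j : ℕ) : (kingSliceKernelsRegEnt S C A msq a k i i').slice j = (kingSliceKernelsReg S C A msq a k).slice j := rfl

/-- same distance as PART Ζ-b's datum. [cite: King1986, (3.62) p.663] -/
theorem dist_ent (x y : HiggsLattice.Site P 0) :
    (kingSliceKernelsRegEnt S C A msq a k i i').dist x y = (kingSliceKernelsReg S C A msq a k).dist x y := rfl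

/-- the torus has more than two sites per direction once `L ≥ 2`, `K ≥ 1`. [cite: Balaban1982Higgs1, (1.2) p.604] -/
theorem two_lt_sitesPerDir (hL : 1 < P.L) (hK : 1 ≤ P.K) (μ : Fin P.d) : 2 < P.sitesPerDir 0 μ := by
  unfold HiggsLattice.Params.sitesPerDir
  have h1 : 2 ≤ P.L ^ (P.K - 0) := by
    rw [Nat.sub_zero]
    calc 2 ≤ P.L := hL
      _ = P.L ^ 1 := (pow_one _).symm
      _ ≤ P.L ^ P.K := Nat.pow_le_pow_right P.hL hK
  have h2 := P.hM
  have h3 := P.hLp μ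
  have h4 : 2 ≤ P.L ^ (P.K - 0) * P.M * P.Lp μ := by
    calc 2 = 2 * 1 * 1 := by norm_num
      _ ≤ P.L ^ (P.K - 0) * P.M * P.Lp μ := Nat.mul_le_mul (Nat.mul_le_mul h1 h2) h3
  omega

/-! ## §2 Transfer -/

/-- ★★ **TRANSFER (entries, King's gauge)**: (2.10) at `(δ, Cst)` and (2.11) at `(α, δ, Cst)` for p26's Hölder carrier, `|A_b| ≤ A_∞`, `d|e|A_∞L^kε ≤ 1`, more than two
sites per direction ⇒ `Prop37PrintedAt α` for the entrywise datum with constants `((3d·e^{δ(d+1)} + 2)·Cst, δ)`. [cite: King1986, Prop 3.7 (3.62)–(3.65) p.663, (3.45) p.661]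
[cite: Balaban1983Higgs3, (2.10)–(2.11) p.426] -/
theorem prop37PrintedAt_entry_of (hS2 : ∀ μ, 2 < P.sitesPerDir 0 μ) {α δ Cst : ℝ} (hα0 : 0 ≤ α) (hα1 : α ≤ 1) (hδ : 0 ≤ δ) (hCst : 0 ≤ Cst)
    (h210 : (regTorusKernelsH S C A msq a k).Ineq210 δ Cst) (h211 : (regTorusKernelsH S C A msq a k).Ineq211At α δ Cst)
    {Asup : ℝ} (hA : ∀ b, |A b| ≤ Asup) (hgauge : (P.d : ℝ) * |C.e| * Asup * P.mesh k ≤ 1) :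
    Prop37PrintedAt α (kingSliceKernelsRegEnt S C A msq a k i i') ((3 * (P.d : ℝ) * Real.exp (δ * (P.d + 1)) + 2) * Cst) δ := by
  rw [ineq210_iff_H] at h210
  set C' : ℝ := (3 * (P.d : ℝ) * Real.exp (δ * (P.d + 1)) + 2) * Cst with hC'
  have hε : 0 < P.mesh 0 := P.mesh_pos 0
  have hmk : 0 < P.mesh k := P.mesh_pos k
  have hfac : (3 : ℝ) ≤ 3 * (P.d : ℝ) * Real.exp (δ * (P.d + 1)) + 2 := by
    have hd1 : (1 : ℝ) ≤ P.d := by exact_mod_cast P.hd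
    have he1 : (1 : ℝ) ≤ Real.exp (δ * (P.d + 1)) := Real.one_le_exp (by positivity)
    nlinarith
  have hCC' : Cst ≤ C' := by rw [hC']; nlinarith
  have h3C : 3 * Cst ≤ C' := by rw [hC']; nlinarith
  have hC'0 : 0 ≤ C' := hCst.trans hCC'
  intro j hj
  have hjk : j + 1 ≤ k := hj
  have hsj : 0 < P.mesh j := P.mesh_pos j
  refine ⟨fun x y => ⟨?_, fun μ => ?_⟩, fun x b => b.elim, fun x y z hxy => ⟨?_, fun μ => ?_⟩⟩
  · have hb := (h210 j x y).1
    rw [scale_eq, regTorusKernels_dist] at hb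
    have he := abs_entG_le (S := S) (C := C) (A := A) (msq := msq) (a := a) (k := k) j i i' x y
    show |P.mesh k ^ ((P.d : ℝ) - 2) * entG C A msq a k j i i' x y|
        ≤ C' * (kingSliceKernelsRegEnt S C A msq a k i i').slice j ^ ((2 : ℝ) - (P.d : ℝ))
          * Real.exp (-(δ * ((kingSliceKernelsRegEnt S C A msq a k i i').slice j)⁻¹ * (kingSliceKernelsRegEnt S C A msq a k i i').dist x y))
    rw [abs_mul, abs_of_nonneg (Real.rpow_nonneg hmk.le _), slice_ent, dist_ent, dist_kingSliceKernelsReg, rate_conv, ← scaling_two' j]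
    calc P.mesh k ^ ((P.d : ℝ) - 2) * |entG C A msq a k j i i' x y|
        ≤ P.mesh k ^ ((P.d : ℝ) - 2) * (Cst * P.mesh j ^ ((2 : ℝ) - (P.d : ℝ)) *
            Real.exp (-(δ * (P.mesh j)⁻¹ * (P.mesh 0 * (HiggsLattice.Site.tdist x y : ℝ))))) :=
          mul_le_mul_of_nonneg_left (he.trans hb) (Real.rpow_nonneg hmk.le _)
      _ = Cst * (P.mesh k ^ ((P.d : ℝ) - 2) * P.mesh j ^ ((2 : ℝ) - (P.d : ℝ))) *
            Real.exp (-(δ * (P.mesh j)⁻¹ * (P.mesh 0 * (HiggsLattice.Site.tdist x y : ℝ)))) := by ring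
      _ ≤ C' * (P.mesh k ^ ((P.d : ℝ) - 2) * P.mesh j ^ ((2 : ℝ) - (P.d : ℝ))) *
            Real.exp (-(δ * (P.mesh j)⁻¹ * (P.mesh 0 * (HiggsLattice.Site.tdist x y : ℝ)))) :=
          mul_le_mul_of_nonneg_right (mul_le_mul_of_nonneg_right hCC' (by positivity)) (Real.exp_nonneg _)
  · have hb := (h210 j x y).2 μ
    rw [scale_eq, regTorusKernels_dist] at hb
    have he := abs_entDG_le (S := S) (C := C) (A := A) (msq := msq) (a := a) (k := k) j μ i i' x y
    show |P.mesh k ^ ((P.d : ℝ) - 1) * entDG C A msq a k j μ i i' x y|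
        ≤ C' * (kingSliceKernelsRegEnt S C A msq a k i i').slice j ^ ((1 : ℝ) - (P.d : ℝ))
          * Real.exp (-(δ * ((kingSliceKernelsRegEnt S C A msq a k i i').slice j)⁻¹ * (kingSliceKernelsRegEnt S C A msq a k i i').dist x y))
    rw [abs_mul, abs_of_nonneg (Real.rpow_nonneg hmk.le _), slice_ent, dist_ent, dist_kingSliceKernelsReg, rate_conv, ← scaling_one' j]
    calc P.mesh k ^ ((P.d : ℝ) - 1) * |entDG C A msq a k j μ i i' x y|
        ≤ P.mesh k ^ ((P.d : ℝ) - 1) * (Cst * P.mesh j ^ ((1 : ℝ) - (P.d : ℝ)) *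
            Real.exp (-(δ * (P.mesh j)⁻¹ * (P.mesh 0 * (HiggsLattice.Site.tdist x y : ℝ))))) :=
          mul_le_mul_of_nonneg_left (he.trans hb) (Real.rpow_nonneg hmk.le _)
      _ = Cst * (P.mesh k ^ ((P.d : ℝ) - 1) * P.mesh j ^ ((1 : ℝ) - (P.d : ℝ))) *
            Real.exp (-(δ * (P.mesh j)⁻¹ * (P.mesh 0 * (HiggsLattice.Site.tdist x y : ℝ)))) := by ring
      _ ≤ C' * (P.mesh k ^ ((P.d : ℝ) - 1) * P.mesh j ^ ((1 : ℝ) - (P.d : ℝ))) *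
            Real.exp (-(δ * (P.mesh j)⁻¹ * (P.mesh 0 * (HiggsLattice.Site.tdist x y : ℝ)))) :=
          mul_le_mul_of_nonneg_right (mul_le_mul_of_nonneg_right hCC' (by positivity)) (Real.exp_nonneg _)
  · -- (3.65)₁ entrywise
    have hxy' : 0 < (kingSliceKernelsReg S C A msq a k).dist x y := hxy
    have hne : x ≠ y := ne_of_dist_pos hxy'
    have hb := entG_holder_le (S := S) (C := C) (A := A) (msq := msq) (a := a) (k := k) hδ hCst h210 hA hgauge hα0 hα1 hjk i i' hne z
    show |((kingSliceKernelsRegEnt S C A msq a k i i').dist x y) ^ (-α) *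
          (P.mesh k ^ ((P.d : ℝ) - 2) * entG C A msq a k j i i' x z - P.mesh k ^ ((P.d : ℝ) - 2) * entG C A msq a k j i i' y z)|
        ≤ C' * (kingSliceKernelsRegEnt S C A msq a k i i').slice j ^ ((2 : ℝ) - (P.d : ℝ) - α)
          * Real.exp (-(δ * ((kingSliceKernelsRegEnt S C A msq a k i i').slice j)⁻¹ *
            min ((kingSliceKernelsRegEnt S C A msq a k i i').dist x z) ((kingSliceKernelsRegEnt S C A msq a k i i').dist y z)))
    rw [← mul_sub, ← mul_assoc, abs_mul, slice_ent, dist_ent, dist_ent, dist_ent,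
      abs_of_nonneg (mul_nonneg (Real.rpow_nonneg (le_of_lt hxy') _) (Real.rpow_nonneg hmk.le _)),
      min_dist_conv, rate_conv, ← scaling_two α j, hC']
    have hw := holderWeight_conv (S := S) (C := C) (A := A) (msq := msq) (a := a) (k := k) (α := α) hne
    set W : ℝ := (kingSliceKernelsReg S C A msq a k).dist x y ^ (-α) with hWdef
    have hW0 : 0 ≤ W := Real.rpow_nonneg (le_of_lt hxy') _
    set E : ℝ := Real.exp (-(δ * (P.mesh j)⁻¹ * (P.mesh 0 * min (HiggsLattice.Site.tdist x z : ℝ) (HiggsLattice.Site.tdist y z : ℝ)))) with hE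
    calc W * P.mesh k ^ ((P.d : ℝ) - 2) * |entG C A msq a k j i i' x z - entG C A msq a k j i i' y z|
        ≤ W * P.mesh k ^ ((P.d : ℝ) - 2) * ((3 * (P.d : ℝ) * Real.exp (δ * (P.d + 1)) + 2) * Cst *
            (P.mesh 0 * (HiggsLattice.Site.tdist x y : ℝ)) ^ α * P.mesh j ^ ((2 : ℝ) - (P.d : ℝ) - α) * E) :=
          mul_le_mul_of_nonneg_left hb (mul_nonneg hW0 (Real.rpow_nonneg hmk.le _))
      _ = (3 * (P.d : ℝ) * Real.exp (δ * (P.d + 1)) + 2) * Cst *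
            ((W * (P.mesh 0 * (HiggsLattice.Site.tdist x y : ℝ)) ^ α) * P.mesh k ^ ((P.d : ℝ) - 2) * P.mesh j ^ ((2 : ℝ) - (P.d : ℝ) - α)) * E := by
          ring
      _ = (3 * (P.d : ℝ) * Real.exp (δ * (P.d + 1)) + 2) * Cst *
            (P.mesh k ^ ((P.d : ℝ) - 2 + α) * P.mesh j ^ ((2 : ℝ) - (P.d : ℝ) - α)) * E := by
          rw [hWdef, hw, mul_comm (P.mesh k ^ α), ← Real.rpow_add hmk]
  · -- (3.65)₂ entrywise
    have hxy' : 0 < (kingSliceKernelsReg S C A msq a k).dist x y := hxy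
    have hne : x ≠ y := ne_of_dist_pos hxy'
    have hb := entDG_holder_le (S := S) (C := C) (A := A) (msq := msq) (a := a) (k := k) hS2 hα0 hα1 hδ hCst h210 h211 hA hgauge hjk μ i i' hne z
    show |((kingSliceKernelsRegEnt S C A msq a k i i').dist x y) ^ (-α) *
          (P.mesh k ^ ((P.d : ℝ) - 1) * entDG C A msq a k j μ i i' x z - P.mesh k ^ ((P.d : ℝ) - 1) * entDG C A msq a k j μ i i' y z)|
        ≤ C' * (kingSliceKernelsRegEnt S C A msq a k i i').slice j ^ ((1 : ℝ) - (P.d : ℝ) - α)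
          * Real.exp (-(δ * ((kingSliceKernelsRegEnt S C A msq a k i i').slice j)⁻¹ *
            min ((kingSliceKernelsRegEnt S C A msq a k i i').dist x z) ((kingSliceKernelsRegEnt S C A msq a k i i').dist y z)))
    rw [← mul_sub, ← mul_assoc, abs_mul, slice_ent, dist_ent, dist_ent, dist_ent,
      abs_of_nonneg (mul_nonneg (Real.rpow_nonneg (le_of_lt hxy') _) (Real.rpow_nonneg hmk.le _)),
      min_dist_conv, rate_conv, ← scaling_one α j]
    have hw := holderWeight_conv (S := S) (C := C) (A := A) (msq := msq) (a := a) (k := k) (α := α) hne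
    set W : ℝ := (kingSliceKernelsReg S C A msq a k).dist x y ^ (-α) with hWdef
    have hW0 : 0 ≤ W := Real.rpow_nonneg (le_of_lt hxy') _
    set E : ℝ := Real.exp (-(δ * (P.mesh j)⁻¹ * (P.mesh 0 * min (HiggsLattice.Site.tdist x z : ℝ) (HiggsLattice.Site.tdist y z : ℝ)))) with hE
    calc W * P.mesh k ^ ((P.d : ℝ) - 1) * |entDG C A msq a k j μ i i' x z - entDG C A msq a k j μ i i' y z|
        ≤ W * P.mesh k ^ ((P.d : ℝ) - 1) * (3 * Cst * (P.mesh 0 * (HiggsLattice.Site.tdist x y : ℝ)) ^ α * P.mesh j ^ ((1 : ℝ) - (P.d : ℝ) - α) * E) :=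
          mul_le_mul_of_nonneg_left hb (mul_nonneg hW0 (Real.rpow_nonneg hmk.le _))
      _ = 3 * Cst * ((W * (P.mesh 0 * (HiggsLattice.Site.tdist x y : ℝ)) ^ α) * P.mesh k ^ ((P.d : ℝ) - 1) * P.mesh j ^ ((1 : ℝ) - (P.d : ℝ) - α)) * E := by
          ring
      _ = 3 * Cst * (P.mesh k ^ ((P.d : ℝ) - 1 + α) * P.mesh j ^ ((1 : ℝ) - (P.d : ℝ) - α)) * E := by
          rw [hWdef, hw, mul_comm (P.mesh k ^ α), ← Real.rpow_add hmk]
      _ ≤ C' * (P.mesh k ^ ((P.d : ℝ) - 1 + α) * P.mesh j ^ ((1 : ℝ) - (P.d : ℝ) - α)) * E :=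
          mul_le_mul_of_nonneg_right (mul_le_mul_of_nonneg_right h3C (by positivity)) (Real.exp_nonneg _)

/-! ## §3 Proposition 3.7 for the entries, BY NAME, in King's gauge -/

/-- ★★★ **KING 1986 PROPOSITION 3.7 BY NAME FOR THE MATRIX ENTRIES `G_(j)(x,y)_{ii′}` AT A REGULAR BACKGROUND, KING's ORDER, IN KING's GAUGE**: as PART Ζ-b's
`prop37PrintedAt_king_regularField` (cube-size threshold, `α ∈ (0,1)`, constants `t, C, δ₀` per cube size, cubic torus `K₀ ∣ M`, `3K₀ ≤ 2M`, `1 ≤ k ≤ K_P`,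
`L^kε ≤ 1`, `A` with one-step differences `≤ δ_A`, `L^kδ_A|e| ≤ t`) PLUS the gauge hypothesis `|A_b| ≤ A_∞`, `d·|e|·A_∞·L^kε ≤ 1` ((3.45)): for all entries `(i,i′)`,
`Prop37PrintedAt α (kingSliceKernelsRegEnt S C A m² a k i i′) (C K₀) (δ₀ K₀)` — King's transport-free (3.62)∕(3.65) on the entries.
[cite: King1986, Prop 3.7 (3.62)–(3.65) p.663, (3.43)–(3.46) p.661, p.665] [cite: Balaban1983Higgs3, (2.10)–(2.11) p.426] [cite: Balaban1982Higgs1, (2.43) p.612] -/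
theorem prop37PrintedAt_king_regularField_entry (d L : ℕ) (hL : Odd L ∧ 1 < L) {a : ℝ} (ha : 0 < a) {msq : ℝ} (hmsq : 0 < msq)
    (N : ℕ) (C : ChargeData N) :
    ∃ K₀min : ℕ, ∀ {α : ℝ}, 0 < α → α < 1 →
      ∃ t Cst δ₀ : ℕ → ℝ, (∀ K₀, 0 < t K₀ ∧ 0 < Cst K₀ ∧ 0 < δ₀ K₀) ∧
      ∀ K₀ : ℕ, K₀min ≤ K₀ →
      ∀ (P : HiggsLattice.Params) (S : Shape P), P.d = d → P.L = L → K₀ ∣ P.M → 3 * K₀ ≤ 2 * P.M →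
      ∀ {k : ℕ}, 1 ≤ k → k ≤ P.K → P.mesh k ≤ 1 →
      ∀ (A : HiggsLattice.VecField P 0) {δA : ℝ}, 0 ≤ δA →
        (∀ (z : HiggsLattice.Site P 0) (μ ν : Fin P.d), |A ⟨z.shift ν, μ⟩ - A ⟨z, μ⟩| ≤ δA) →
        (P.L : ℝ) ^ k * δA * |C.e| ≤ t K₀ →
      ∀ {Asup : ℝ}, (∀ b, |A b| ≤ Asup) → (P.d : ℝ) * |C.e| * Asup * P.mesh k ≤ 1 →
      ∀ (i i' : Ix N), Prop37PrintedAt α (kingSliceKernelsRegEnt S C A msq a k i i') (Cst K₀) (δ₀ K₀) := by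
  obtain ⟨K₀min, h⟩ := ineq210_and_211At_regularTorusH d L hL ha hmsq N C
  refine ⟨K₀min, fun {α} hα0 hα1 => ?_⟩
  obtain ⟨t, δ₁, Cst, hpos, h'⟩ := h hα0.le hα1
  refine ⟨t, fun K₀ => (3 * (d : ℝ) * Real.exp (δ₁ K₀ * (d + 1)) + 2) * Cst K₀, δ₁,
    fun K₀ => ⟨(hpos K₀).1, mul_pos (by positivity) (hpos K₀).2.2, (hpos K₀).2.1⟩, ?_⟩
  intro K₀ hK₀ P S hPd hPL hK₀M h3M k hk1 hkK hmesh A δA hδA hreg ht Asup hA hgauge i i'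
  obtain ⟨h210, h211⟩ := h' K₀ hK₀ P S hPd hPL hK₀M h3M hk1 hkK hmesh A hδA hreg ht
  have hS2 : ∀ μ, 2 < P.sitesPerDir 0 μ := two_lt_sitesPerDir S.hL.2 (hk1.trans hkK)
  have hmain := prop37PrintedAt_entry_of (S := S) (C := C) (A := A) (msq := msq) (a := a) (k := k) (i := i) (i' := i')
    hS2 hα0.le hα1.le (hpos K₀).2.1.le (hpos K₀).2.2.le h210 h211 hA hgauge
  subst hPd
  exact hmain

/-- ★★★ **`Prop37KingOrder` FOR THE ENTRIES AT `A = 0`** (both the regularity smallness and the gauge hypothesis are trivial at the zero field): King's (3.62)∕(3.65)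
in King's OWN transport-free reading for King's own `A = 0` torus model, through the regular-field pipeline. [cite: King1986, Prop 3.7 p.663] [cite: Balaban1983Higgs3, (2.10)–(2.11) p.426] -/
theorem prop37KingOrder_king_zeroField_entry (d L : ℕ) (hL : Odd L ∧ 1 < L) {a : ℝ} (ha : 0 < a) {msq : ℝ} (hmsq : 0 < msq)
    (N : ℕ) (C : ChargeData N) :
    ∃ K₀min : ℕ, ∀ K₀ : ℕ, K₀min ≤ K₀ →
      ∀ (P : HiggsLattice.Params) (S : Shape P), P.d = d → P.L = L → K₀ ∣ P.M → 3 * K₀ ≤ 2 * P.M →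
      ∀ {k : ℕ}, 1 ≤ k → k ≤ P.K → P.mesh k ≤ 1 →
      ∀ (i i' : Ix N), Prop37KingOrder (kingSliceKernelsRegEnt S C (0 : HiggsLattice.VecField P 0) msq a k i i') := by
  obtain ⟨K₀min, h⟩ := prop37PrintedAt_king_regularField_entry d L hL ha hmsq N C
  refine ⟨K₀min, fun K₀ hK₀ P S hPd hPL hK₀M h3M k hk1 hkK hmesh i i' α hα0 hα1 => ?_⟩
  obtain ⟨t, Cst, δ₀, hpos, h'⟩ := h hα0 hα1
  refine ⟨Cst K₀, δ₀ K₀, (hpos K₀).2.2, ?_⟩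
  refine h' K₀ hK₀ P S hPd hPL hK₀M h3M hk1 hkK hmesh 0 (δA := 0) le_rfl (fun z μ ν => by simp) ?_ (Asup := 0) (fun b => by simp) ?_ i i'
  · rw [mul_zero, zero_mul]; exact (hpos K₀).1.le
  · rw [mul_zero, zero_mul]; exact zero_le_one

end Ent

end Summit.QuantumFields.YangMills.BalabanUVNodes.N15KingModelRung.RegularField

end
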